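import Literature.Probability.RandomPlanarGeometry.YangBaxterSAWUnwoundPlaquette
import Literature.Barriers.CriticalPhenomena.PlaquetteWalkYBIdentityIsthmusAllSpins
import HarnessLib

/-!
# Barrier catalogue (SAWScalingLimit): DEFECT CONFINEMENT for hole roots — two-door root plaquettes, and
pockets behind a valve (thick roots included)

Companion of `PlaquetteWalkHoleRootDefect` / `PlaquetteWalkHoleRootFarCell` / `PlaquetteWalkIsthmusRoot` (this
catalogue) and of `YangBaxterSAWUnwoundPlaquette` (topic `RandomPlanarGeometry`: the per-plaquette unwound
criterion — if no excursion polygon at the rhombus `r` winds around the midpoint of the root `a`,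
`UnwoundAt D a r`, then Glazman–Manolescu's vertex relation (CR) holds at `r`, for hole roots as well as outer
roots). For a root on the boundary of a HOLE the relation fails at some plaquettes (the lane's C-B2 hole datum,
`PlaquetteWalkHoleRootDefect`); this file proves structural criteria saying WHERE it still holds, each for
every `θ ∈ [π/3, 2π/3]` and every finite face domain.

* **Transport through avoided faces** (`ΩG.ExcursionAvoids`, `ΩG.far_ctr_of_avoids`,
  `ΩG.AJ_ctr_eq_AJ_corner_of_avoids`, `ΩG.AJ_root_eq_AJ_ctr_of_avoids`, `ΩG.AJ_root_eq_zero_of_avoiding_chain`):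
  the parent file transports the winding angle `AJ` of an excursion polygon `J` from the midpoint of the root to
  the centre of a face beyond the domain along a king chain of faces OUTSIDE the domain (`J` stays at squared
  distance `≥ 9` from their centres). The same estimates hold for every face of the domain in which the
  excursion has no arc: the chain may run through faces of `D` avoided by the excursion. This is the tool for
  hole roots, whose exterior face is NOT king-joined to infinity outside `D`.
* **Two-door root plaquettes** (`ΩG.fc_ne_root_face_of_two_doors`, `unwoundAt_of_two_door_rim_root`,
  `vertexFunctional_printed_eq_zero_of_two_door_rim_root`): if the root plaquette `w` (the only face of `D` at
  `a`) has at most two doors (sides that are interior edges of `D`), every walk from `a` crosses `w` with its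
  first arc only — a later arc in `w` would cross two doors, one of them the exit door of the first arc; so if
  `w` is king-joined through exterior faces to a face beyond `D`, every `r ≠ w` is unwound and the printed
  weights satisfy the vertex relation at every `f₀ ≠ w`: the defect of such a root is CONFINED TO THE ROOT
  PLAQUETTE. (For a root whose OPPOSITE side faces the outside this is the tree's isthmus theorem
  `vertexFunctional_printed_eq_zero_of_isthmus` of `PlaquetteWalkIsthmusRoot`, proved there by an elementary
  re-rooting bijection; the present version allows the exterior contact on a lateral side or through a corner
  and is proved by the winding transport.)
* **Pockets behind a valve** (`ΩG.fc_mem_pocket_of_valve`, `unwoundAt_of_valve`,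
  `vertexFunctional_printed_eq_zero_of_valve`): let the pocket `B ⊆ D` avoid `w`, and let every face of `D`
  outside `B` sharing a side with a face of `B` be one VALVE face `c ≠ w` with at most two doors. A walk from
  `a` reaching a rhombus `r ∈ B` entered the pocket through `c`, crossing both doors of the valve; hence the
  excursion of a class-`B2a` walk at `r` never leaves the pocket, and if `w` is king-joined to a face beyond
  `D` through faces off the pocket, `r` is unwound and the vertex relation holds at `r` — for ANY boundary
  root off the pocket, in particular for THICK hole roots (the plaquette across the opposite side of `w`
  inside `D`), at which no structural zero was available beyond the plaquettes with at most two doors of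
  `vertexFunctional_printed_eq_zero_of_two_doors` (`YangBaxterSAWUnwoundPlaquette`): the walks reaching the
  pocket may have circled the hole, their excursions cannot. («Pocket» here is a set of faces `B` sealed by a
  valve, with zeros at the faces of `B` away from `w`; not the tree's «pocket hole root» of
  `PlaquetteWalkSeparatedExits` / `YangBaxterSAWUnwoundPlaquette`, whose zero sits at `w` itself.)
* **Regions behind a two-door cut** (`ΩG.fc_mem_of_two_door_cut`, `unwoundAt_of_two_door_cut`,
  `vertexFunctional_printed_eq_zero_of_two_door_cut`) — the common generalisation of the two previous items:
  if at most two mid-edges are doors between the faces of a region `B ∌ w` and the other faces of `D`, the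
  excursion of every class-`B2a` walk at a rhombus `r ∈ B` has all its arcs in `B`. Mark each arc «in»/«off»
  by whether its face lies in `B` (the endpoint on `∂r` counts as «in»): the marks go off (first arc, in `w`) →
  in (the arc at the first hit, in `r`) → off (an excursion arc off `B`) → in (the end), and each change happens
  at a distinct crossed door of the cut — three doors where there are two. With a king chain from `w` to beyond
  `D` off `B`, every `r ∈ B` is unwound and the vertex relation holds on `B`, for any boundary root off `B`.
  Instance `neck`: the thick ring `5 × 5 ∖ (2,2)` with a `2 × 3` block attached through a width-TWO neck — the
  eight plaquettes behind the two neck doors satisfy the relation for the thick root `W` side of `(3,2)`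
  (`vertexFunctional_printed_neck_region_eq_zero`; lane data: exact zeros, walks winding twice before entering).
* **Instances.** `pendant` (the venture lane's domain `4 × 3 ∖ {(1,1)} ⊕ corridor (4,1) ⊕ block {5,6} × {0,1,2}`)
  rooted at the thick hole root `W` side of `(2,1)`: the vertex relation holds at all six block plaquettes
  (`vertexFunctional_printed_pendant_block_eq_zero`; the lane's exact data at `θ = π/3, π/2, 2π/3`: zero there,
  nonzero at `(2,0), (2,1), (2,2), (3,1)`). `holedBox m n h` (the `m × n` box minus the face `h`) rooted at the
  `N` side of the hole with the root plaquette on the top row (`h.2 + 2 = n`, a two-door rim root):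
  `vertexFunctional_printed_holedBox_topRow_eq_zero` — the relation holds at every face `≠ (h.1, h.2 + 1)`,
  every `m`, `h.1`, `θ` (the lane's thin-ring far-cell zeros of its (R-9) record, all box sizes at once; exact
  data: `3×3∖(1,1)`, `4×3∖(1,1)`, `4×4∖(1,2)`, `4×4∖(2,2)`, `5×4∖(1,2)`, `5×4∖(2,2)`, `5×4∖(3,2)`, `5×5∖(1,3)`,
  `6×4∖(1,2)`, `6×4∖(3,2)`, `6×5∖(1,3)`, `7×4∖(1,2)` at up to three `θ`: every face zero except the root
  plaquette, which is nonzero). Named statements `PlaquetteWalkPocketConfinement` / `PlaquetteWalkThinRingConfinement`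
  with `_holds`.
* **Whole curve, all sixteen spins** (Appendix): for fixed `(Dl, a, f₀)` a zero for every printed `θ` is a zero
  of the functional of `ybCurve (−1) t r` with `(1, r, −1, −r)` at every `r ≠ 0` off the denominator
  (`vertexFunctional_ybCurve_eq_zero_of_printed`, continuation in `r` as in `PlaquetteWalkYBCurveIdentity`) and
  at every spin `t¹⁶ = −1` (`…_of_printed_of_pow_sixteen`, by the spin transfer of
  `PlaquetteWalkYBIdentityIsthmusAllSpins`); hence every confinement zero above holds there
  (`vertexFunctional_ybCurve_eq_zero_of_two_door_cut_of_pow_sixteen`, `…_pendant_block_…`, `…_holedBox_topRow_…`).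

References: A. Glazman, I. Manolescu, arXiv:1708.00395v3, Lemma 2.1 and eq. (2.2) [GlazmanManolescu2019];
its proof: A. Glazman, Electron. Commun. Probab. 20 (2015) no. 86, Lemma 3.1, proof pp. 6–7 (the classes of
walks through a rhombus; the winding of the grouped walks) [Glazman2015WeightedSAW]; H. Duminil-Copin,
S. Smirnov, Ann. of Math. 175 (2012), Lemma 1 and its proof («we used the fact that a is on the boundary and Ω
is simply connected») [DuminilCopinSmirnov2012]. Status in print: the vertex relation is printed for simply
connected domains rooted on the boundary only; the two criteria for domains with holes are the lane's (not
located in print; label of the lane's literature desk owed). Kernel-checked with the standard axioms; the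
private plumbing of `YangBaxterSAWGeneralDomain` and of `PlaquetteWalkYBCurveIdentity` is read via
`open private … from` (as in `YangBaxterSAWUnwoundPlaquette`). Editions: ed.3 = first tree edition
(proposal p383567); ed.4 = ed.3 verbatim ⊕ the Appendix (curve / all spins) and one import. Written for the
venture lane «pcv-sawmu» (Tier B SEARCH 1, b-engine-1 gen 16).
-/

noncomputable section

open Real Complex

namespace Literature.Probability.RandomPlanarGeometry.SAW.YangBaxter

open private pJpt_cases' far_corner far_midPt sdot_pJpt_of_far AJ_eq_AJ_of_sdot
  nine_le_distSq_innerPt_ctr sdot_ctr_corner_pos sdot_midPt_ctr_pos arcFace_firstHitG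
  from Literature.Probability.RandomPlanarGeometry.YangBaxterSAWGeneralDomain

variable {D : Set Face} {a : MidEdge} {r : Face}

namespace ΩG

variable (ω : ΩG D a r)

/-- **The excursion avoids the face `g`**: `g` is not the rhombus `r` of the class and no arc of the
walk after its first hit of `∂r` lies in `g` (so the excursion polygon `J` stays out of the closed square
of `g`). [cite: Glazman2015WeightedSAW, Lemma 3.1 (proof: the winding of the grouped walks)] -/
def ExcursionAvoids (g : Face) : Prop :=
  g ≠ r ∧ ∀ i, ω.2.firstHitG < i → i < ω.2.arcs.length → ω.2.fc i ≠ g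

variable {ω} (hr : RootedFace D a r)

/-- A face outside the domain is avoided. [cite: Glazman2015WeightedSAW, Lemma 3.1 (proof: the winding of the grouped walks)] -/
theorem excursionAvoids_of_not_mem (hr : RootedFace D a r) {g : Face} (hg : g ∉ D) : ω.ExcursionAvoids g :=
  ⟨fun h => hg (h ▸ hr.mem), fun _ _ hi h => hg (h ▸ (YBWalk.arcFace_arcAt hi).2)⟩

/-- `J` is far (squared distance `≥ 9`) from the centre of every avoided face. [cite: Glazman2015WeightedSAW, Lemma 3.1 (proof: the winding of the grouped walks)] -/
theorem far_ctr_of_avoids (h : ω.IsB2a) {g : Face} (hg : ω.ExcursionAvoids g) {k : ℕ} (hk : k ≤ 2 * ω.Mv) :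
    9 ≤ ((ω.pJpt hr h k).1 - (Face.ctr g).1) ^ 2 + ((ω.pJpt hr h k).2 - (Face.ctr g).2) ^ 2 := by
  rcases pJpt_cases' (ω := ω) (hr := hr) h hk with ⟨i, hi1, hi2, e | e⟩ | e | e
  · rw [e]; exact nine_le_distSq_innerPt_ctr (hg.2 i hi1 hi2) _
  · rw [e]; exact nine_le_distSq_innerPt_ctr (hg.2 i hi1 hi2) _
  · rw [e]; exact nine_le_distSq_innerPt_ctr (Ne.symm hg.1) _
  · rw [e]; exact nine_le_distSq_innerPt_ctr (Ne.symm hg.1) _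

/-- **Transport centre → corner through an avoided face.** [cite: Glazman2015WeightedSAW, Lemma 3.1 (proof: the winding of the grouped walks)] -/
theorem AJ_ctr_eq_AJ_corner_of_avoids (h : ω.IsB2a) {g : Face} (hg : ω.ExcursionAvoids g) {q : ℤ × ℤ}
    (hq : IsCornerOf q g) : ω.AJ hr h (toC (Face.ctr g)) = ω.AJ hr h (toC (cornerPt q)) := by
  refine AJ_eq_AJ_of_sdot (ω := ω) (hr := hr) h _ _ (fun k hk => ?_) (fun k hk => ?_) (fun k hk => ?_)
  · exact sdot_pJpt_of_far (ω := ω) (hr := hr) h _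
      (fun k' hk' => le_trans (by norm_num) (far_ctr_of_avoids hr h hg hk')) hk
  · exact sdot_pJpt_of_far (ω := ω) (hr := hr) h _ (fun k' hk' => far_corner (ω := ω) (hr := hr) h q hk') hk
  · exact sdot_ctr_corner_pos hq (far_ctr_of_avoids hr h hg hk) (far_corner (ω := ω) (hr := hr) h q hk)

/-- **Transport root midpoint → centre of an avoided face having the root as a side.** [cite: Glazman2015WeightedSAW, Lemma 3.1 (proof: the winding of the grouped walks)] -/
theorem AJ_root_eq_AJ_ctr_of_avoids (h : ω.IsB2a) {g : Face} (hg : ω.ExcursionAvoids g) {s : Side}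
    (hs : g.side s = a) : ω.AJ hr h (toC (midPt a)) = ω.AJ hr h (toC (Face.ctr g)) := by
  refine AJ_eq_AJ_of_sdot (ω := ω) (hr := hr) h _ _ (fun k hk => ?_) (fun k hk => ?_) (fun k hk => ?_)
  · have h0 := ω.sdot_pJpt_midPt (hr := hr) h (Nat.zero_le _) hk
    rw [ω.2.nth_zero] at h0
    exact h0
  · exact sdot_pJpt_of_far (ω := ω) (hr := hr) h _
      (fun k' hk' => le_trans (by norm_num) (far_ctr_of_avoids hr h hg hk')) hk
  · have hz := sdot_midPt_ctr_pos g s (far_ctr_of_avoids hr h hg hk) (far_midPt (ω := ω) (hr := hr) h (g.side s) hk)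
    rw [hs] at hz
    exact hz

/-- **Transport along a king chain of avoided faces, from the root to the last centre.** [cite: Glazman2015WeightedSAW, Lemma 3.1 (proof: the winding of the grouped walks)] -/
theorem AJ_root_eq_AJ_ctr_of_avoiding_chain (h : ω.IsB2a) {n : ℕ} {g : ℕ → Face}
    (hroot : ∃ s : Side, (g 0).side s = a) (hav : ∀ i ≤ n, ω.ExcursionAvoids (g i))
    (hlink : ∀ i < n, ∃ q : ℤ × ℤ, IsCornerOf q (g i) ∧ IsCornerOf q (g (i + 1))) :
    ω.AJ hr h (toC (midPt a)) = ω.AJ hr h (toC (Face.ctr (g n))) := by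
  obtain ⟨s, hs⟩ := hroot
  rw [AJ_root_eq_AJ_ctr_of_avoids hr h (hav 0 (Nat.zero_le _)) hs]
  have key : ∀ m ≤ n, ω.AJ hr h (toC (Face.ctr (g 0))) = ω.AJ hr h (toC (Face.ctr (g m))) := by
    intro m
    induction m with
    | zero => intro; rfl
    | succ m ih =>
      intro hm
      obtain ⟨q, hq1, hq2⟩ := hlink m (by omega)
      rw [ih (by omega), AJ_ctr_eq_AJ_corner_of_avoids hr h (hav m (by omega)) hq1,
        ← AJ_ctr_eq_AJ_corner_of_avoids hr h (hav (m + 1) hm) hq2]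
  exact key n le_rfl

/-- **The excursion polygon does not wind around the root** when a king chain of avoided faces joins
the root to a face beyond the domain. [cite: Glazman2015WeightedSAW, Lemma 3.1 (proof: the winding of the grouped walks)] -/
theorem AJ_root_eq_zero_of_avoiding_chain (h : ω.IsB2a) {n : ℕ} {g : ℕ → Face}
    (hroot : ∃ s : Side, (g 0).side s = a) (hav : ∀ i ≤ n, ω.ExcursionAvoids (g i))
    (hlink : ∀ i < n, ∃ q : ℤ × ℤ, IsCornerOf q (g i) ∧ IsCornerOf q (g (i + 1))) (hD : g n ∉ D)
    (hb : (∀ f ∈ D, (g n).1 < f.1) ∨ (∀ f ∈ D, f.1 < (g n).1) ∨ (∀ f ∈ D, (g n).2 < f.2) ∨ (∀ f ∈ D, f.2 < (g n).2)) :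
    ω.AJ hr h (toC (midPt a)) = 0 := by
  rw [AJ_root_eq_AJ_ctr_of_avoiding_chain hr h hroot hav hlink]
  exact ω.AJ_ctr_eq_zero_of_beyond (hr := hr) h hD hb

end ΩG

/-! ### A root plaquette with at most two doors is crossed only by the first arc -/

/-- Two distinct faces of the domain having the mid-edge `e` as a side are its two faces: `e` is a door
(an interior edge of the domain). [cite: GlazmanManolescu2019, §1 (the lattice of rhombi and its mid-edges)] -/
theorem door_of_two_faces {e : MidEdge} {f f' : Face} (hf : ∃ s, f.side s = e) (hf' : ∃ s, f'.side s = e)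
    (hne : f ≠ f') (hD : f ∈ D) (hD' : f' ∈ D) : e.faces.1 ∈ D ∧ e.faces.2 ∈ D := by
  rcases (Face.exists_side_eq_iff f e).1 hf with h1 | h1 <;> rcases (Face.exists_side_eq_iff f' e).1 hf' with h2 | h2
  · exact absurd (h1.trans h2.symm) hne
  · exact ⟨h1 ▸ hD, h2 ▸ hD'⟩
  · exact ⟨h2 ▸ hD', h1 ▸ hD⟩
  · exact absurd (h1.trans h2.symm) hne

namespace YBWalk

variable {z : MidEdge} (γ : YBWalk D a z)

/-- The sides of the `i`-th arc through `nth`. [cite: GlazmanManolescu2019, §1 (the lattice of rhombi and its mid-edges)] -/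
theorem side_sIn_nth {i : ℕ} (hi : i < γ.arcs.length) :
    (γ.fc i).side (γ.sIn i) = γ.nth i ∧ (γ.fc i).side (γ.sOut i) = γ.nth (i + 1) ∧ γ.sIn i ≠ γ.sOut i := by
  obtain ⟨h1, h2, h3⟩ := YBWalk.side_sIn hi
  have hl := γ.length_eq
  refine ⟨?_, ?_, h3⟩
  · rw [h1, γ.nth_eq_getElem (by omega)]
  · rw [h2, γ.nth_eq_getElem (by omega)]

/-- **An interior mid-edge of the walk is a door**: for `0 < j < n` both faces of the `j`-th mid-edge
lie in the domain (it is the exit side of the `(j-1)`-st arc and the entry side of the `j`-th, two arcs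
in different faces of `D`). [cite: Glazman2015WeightedSAW, Lemma 3.1 (proof: the classes of walks through a rhombus)] -/
theorem door_nth {j : ℕ} (hj0 : 0 < j) (hj : j < γ.arcs.length) :
    (γ.nth j).faces.1 ∈ D ∧ (γ.nth j).faces.2 ∈ D := by
  obtain ⟨-, h1, -⟩ := γ.side_sIn_nth (i := j - 1) (by omega)
  obtain ⟨h2, -, -⟩ := γ.side_sIn_nth hj
  rw [show j - 1 + 1 = j by omega] at h1
  have hne := YBWalk.fc_succ_ne (γ := γ) (i := j - 1) (by omega)
  rw [show j - 1 + 1 = j by omega] at hne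
  exact door_of_two_faces ⟨_, h1⟩ ⟨_, h2⟩ hne
    (YBWalk.arcFace_arcAt (γ := γ) (i := j - 1) (by omega)).2 (YBWalk.arcFace_arcAt hj).2

end YBWalk

namespace ΩG

variable {ω : ΩG D a r} (hr : RootedFace D a r)

/-- **A root plaquette with at most two doors is crossed by the first arc only.** If `w` is the only face
of the domain having the root `a` as a side, and at most two sides of `w` are doors (interior edges of
`D`), then no arc of a walk from `a` to `∂r` (`r ≠ w`) other than the first lies in `w`: such an arc
would cross two doors of `w`, one of which is the exit door of the first arc — crossed twice.
[cite: Glazman2015WeightedSAW, Lemma 3.1 (proof: the classes of walks through a rhombus)] -/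
theorem fc_ne_root_face_of_two_doors (hr : RootedFace D a r) {w : Face}
    (huniq : ∀ f ∈ D, (∃ s, f.side s = a) → f = w) (hwr : w ≠ r) (s₁ s₂ : Side)
    (hdoors : ∀ s : Side, ((w.side s).faces.1 ∈ D ∧ (w.side s).faces.2 ∈ D) → s = s₁ ∨ s = s₂)
    {i : ℕ} (hi0 : 0 < i) (hi : i < ω.2.arcs.length) : ω.2.fc i ≠ w := by
  intro hfw
  set γ := ω.2 with hγ
  have hn : 1 < γ.arcs.length := by omega
  -- the first arc lies in `w`
  obtain ⟨h0in, h0out, -⟩ := γ.side_sIn_nth (i := 0) (by omega)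
  rw [γ.nth_zero] at h0in
  have hfc0 : γ.fc 0 = w := huniq _ (YBWalk.arcFace_arcAt (γ := γ) (i := 0) (by omega)).2 ⟨_, h0in⟩
  rw [hfc0, zero_add] at h0out
  -- the exit door of the first arc
  have hd1 : γ.sOut 0 = s₁ ∨ γ.sOut 0 = s₂ := hdoors _ (h0out ▸ γ.door_nth one_pos hn)
  -- the two doors of the `i`-th arc
  obtain ⟨hiin, hiout, hio⟩ := γ.side_sIn_nth hi
  rw [hfw] at hiin hiout
  have hdin : γ.sIn i = s₁ ∨ γ.sIn i = s₂ := hdoors _ (hiin ▸ γ.door_nth hi0 hi)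
  have hdout : γ.sOut i = s₁ ∨ γ.sOut i = s₂ := by
    refine hdoors _ ?_
    rcases Nat.lt_or_ge (i + 1) γ.arcs.length with hlt | hge
    · exact hiout ▸ γ.door_nth (Nat.succ_pos _) hlt
    · -- the last arc: its exit side is the endpoint, a side of `r ≠ w`
      have hlen : i + 1 = γ.arcs.length := by omega
      have hz : γ.nth (i + 1) = r.side ω.1 := by rw [hlen]; exact γ.nth_length
      rw [hz] at hiout
      rw [hiout]
      exact door_of_two_faces (e := r.side ω.1) (f := w) (f' := r) ⟨_, hiout⟩ ⟨ω.1, rfl⟩ hwr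
        (hfw ▸ (YBWalk.arcFace_arcAt hi).2) hr.mem
  -- the exit door of the first arc is one of them: crossed twice
  have hl := γ.length_eq
  rcases hd1 with e1 | e1 <;> rcases hdin with e2 | e2 <;> rcases hdout with e3 | e3 <;>
    first
    | (have e : γ.nth 1 = γ.nth i := by rw [← h0out, ← hiin, e1, e2]
       have := γ.nth_inj (by omega) (by omega) e
       subst this
       exact YBWalk.fc_succ_ne (γ := γ) (i := 0) hn (hfc0.trans hfw.symm))
    | (have e : γ.nth 1 = γ.nth (i + 1) := by rw [← h0out, ← hiout, e1, e3]
       have := γ.nth_inj (by omega) (by omega) e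
       omega)
    | exact absurd (e2.trans e3.symm) hio

/-- Hence the excursion of every walk of class `B2a` at `r ≠ w` avoids the root plaquette `w`.
[cite: Glazman2015WeightedSAW, Lemma 3.1 (proof: the classes of walks through a rhombus)] -/
theorem excursionAvoids_root_face_of_two_doors (hr : RootedFace D a r) {w : Face}
    (huniq : ∀ f ∈ D, (∃ s, f.side s = a) → f = w) (hwr : w ≠ r) (s₁ s₂ : Side)
    (hdoors : ∀ s : Side, ((w.side s).faces.1 ∈ D ∧ (w.side s).faces.2 ∈ D) → s = s₁ ∨ s = s₂) :
    ω.ExcursionAvoids w :=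
  ⟨hwr, fun _ hi1 hi2 => fc_ne_root_face_of_two_doors hr huniq hwr s₁ s₂ hdoors (by omega) hi2⟩

end ΩG

/-! ### A pocket behind a two-door valve: the excursion stays in the pocket -/

namespace YBWalk

variable {z : MidEdge} (γ : YBWalk D a z)

/-- The face of the `i`-th arc from its `arcFace`. [cite: GlazmanManolescu2019, §1 (the lattice of rhombi and its mid-edges)] -/
theorem fc_eq_of_arcFace_nth {i : ℕ} (hi : i < γ.arcs.length) {f : Face}
    (h : arcFace (γ.nth i, γ.nth (i + 1)) = some f) : γ.fc i = f := by
  have h1 := (YBWalk.arcFace_arcAt (γ := γ) hi).1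
  have hl := γ.length_eq
  rw [YBWalk.arcAt_eq hi, ← γ.nth_eq_getElem (by omega), ← γ.nth_eq_getElem (by omega), h] at h1
  exact (Option.some.inj h1).symm

/-- Consecutive arcs lie in faces sharing the mid-edge between them. [cite: GlazmanManolescu2019, §1 (the lattice of rhombi and its mid-edges)] -/
theorem adjacent_fc_succ {i : ℕ} (hi : i + 1 < γ.arcs.length) :
    ∃ s s', (γ.fc (i + 1)).side s = (γ.fc i).side s' := by
  obtain ⟨-, h1, -⟩ := γ.side_sIn_nth (i := i) (by omega)
  obtain ⟨h2, -, -⟩ := γ.side_sIn_nth hi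
  exact ⟨_, _, h2.trans h1.symm⟩

end YBWalk

namespace ΩG

variable {ω : ΩG D a r}

/-- **Pocket confinement.** Let the pocket `B ⊆ D` contain the rhombus `r` but not the root plaquette `w`
(the only face of `D` at the root `a`), and let every face of `D` outside `B` that shares a side with a face of
`B` be the single VALVE face `c ∉ B`, `c ≠ w`, which has at most two doors. Then the excursion of every walk
of class `B2a` at `r` stays inside the pocket: the prefix from `a` entered `B` through `c`, crossing both doors
of the valve, so the excursion can never cross the valve again.
[cite: Glazman2015WeightedSAW, Lemma 3.1 (proof: the classes of walks through a rhombus)] -/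
theorem fc_mem_pocket_of_valve (hr : RootedFace D a r) (h : ω.IsB2a) {w c : Face} {B : Set Face}
    (huniq : ∀ f ∈ D, (∃ s, f.side s = a) → f = w) (hwB : w ∉ B) (hcw : c ≠ w) (hrB : r ∈ B)
    (s₁ s₂ : Side) (hdoors : ∀ s : Side, ((c.side s).faces.1 ∈ D ∧ (c.side s).faces.2 ∈ D) → s = s₁ ∨ s = s₂)
    (hvalve : ∀ f ∈ B, ∀ g ∈ D, g ∉ B → (∃ s s', f.side s = g.side s') → g = c)
    {i : ℕ} (hi1 : ω.2.firstHitG < i) (hi2 : i < ω.2.arcs.length) : ω.2.fc i ∈ B := by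
  set γ := ω.2 with hγ
  have hfh : γ.firstHitG < γ.arcs.length := ω.fh_lt h
  -- the arc at the first hit lies in `r ∈ B`
  have hfc_fh : γ.fc γ.firstHitG = r := γ.fc_eq_of_arcFace_nth hfh (arcFace_firstHitG γ hr hfh)
  -- the first arc lies in `w ∉ B`
  obtain ⟨h0in, -, -⟩ := γ.side_sIn_nth (i := 0) (by omega)
  rw [γ.nth_zero] at h0in
  have hfc0 : γ.fc 0 = w := huniq _ (YBWalk.arcFace_arcAt (γ := γ) (i := 0) (by omega)).2 ⟨_, h0in⟩
  -- Step A: the prefix crosses the valve — some arc `j - 1 < firstHit` lies in `c`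
  have hA : ∃ j, 1 ≤ j ∧ j ≤ γ.firstHitG ∧ γ.fc (j - 1) = c := by
    by_contra hno
    have H : ∀ j, 1 ≤ j → j ≤ γ.firstHitG → γ.fc (j - 1) ≠ c := fun j h1 h2 e => hno ⟨j, h1, h2, e⟩
    have key : ∀ k ≤ γ.firstHitG, γ.fc k ∉ B := by
      intro k
      induction k with
      | zero => intro; rw [hfc0]; exact hwB
      | succ k ih =>
        intro hk hmem
        have hk' : γ.fc k ∉ B := ih (by omega)
        have hadj := γ.adjacent_fc_succ (i := k) (by omega)
        have hc : γ.fc k = c :=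
          hvalve _ hmem _ (YBWalk.arcFace_arcAt (γ := γ) (i := k) (by omega)).2 hk' hadj
        exact H (k + 1) (by omega) hk (by simpa using hc)
    exact key _ le_rfl (by rw [hfc_fh]; exact hrB)
  obtain ⟨j, hj1, hj2, hjc⟩ := hA
  have hj0 : 2 ≤ j := by
    by_contra hlt
    have : j = 1 := by omega
    subst this
    exact hcw (hjc.symm.trans hfc0)
  -- both doors of the valve are the sides of the arc `j - 1`
  obtain ⟨hjin, hjout, hjio⟩ := γ.side_sIn_nth (i := j - 1) (by omega)
  rw [hjc] at hjin hjout
  rw [show j - 1 + 1 = j by omega] at hjout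
  have hdin : γ.sIn (j - 1) = s₁ ∨ γ.sIn (j - 1) = s₂ := hdoors _ (hjin ▸ γ.door_nth (by omega) (by omega))
  have hdout : γ.sOut (j - 1) = s₁ ∨ γ.sOut (j - 1) = s₂ := hdoors _ (hjout ▸ γ.door_nth (by omega) (by omega))
  -- Step B: induction along the excursion
  have key : ∀ k, γ.firstHitG ≤ k → k < γ.arcs.length → γ.fc k ∈ B := by
    intro k
    induction k with
    | zero => intro hk _; rw [show γ.firstHitG = 0 by omega] at hfc_fh; rw [hfc_fh]; exact hrB
    | succ k ih =>
      intro hk hk2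
      rcases Nat.lt_or_ge γ.firstHitG (k + 1) with hlt | hge
      · have hkB : γ.fc k ∈ B := ih (by omega) (by omega)
        by_contra hmem
        obtain ⟨t, t', het⟩ := γ.adjacent_fc_succ (i := k) hk2
        have hc : γ.fc (k + 1) = c :=
          hvalve _ hkB _ (YBWalk.arcFace_arcAt (γ := γ) hk2).2 hmem ⟨t', t, het.symm⟩
        -- the entry side of the arc `k + 1` is a door of `c`, hence one of the two doors already crossed
        obtain ⟨hkin, -, -⟩ := γ.side_sIn_nth hk2
        rw [hc] at hkin
        have hd : γ.sIn (k + 1) = s₁ ∨ γ.sIn (k + 1) = s₂ := hdoors _ (hkin ▸ γ.door_nth (by omega) hk2)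
        have hl := γ.length_eq
        have hcases : γ.sIn (k + 1) = γ.sIn (j - 1) ∨ γ.sIn (k + 1) = γ.sOut (j - 1) := by
          rcases hd with e1 | e1 <;> rcases hdin with e2 | e2 <;> rcases hdout with e3 | e3 <;>
            first
            | exact Or.inl (e1.trans e2.symm)
            | exact Or.inr (e1.trans e3.symm)
            | exact absurd (e2.trans e3.symm) hjio
        rcases hcases with e | e
        · have heq : γ.nth (k + 1) = γ.nth (j - 1) := by rw [← hkin, ← hjin, e]
          have := γ.nth_inj (by omega) (by omega) heq
          omega
        · have heq : γ.nth (k + 1) = γ.nth j := by rw [← hkin, ← hjout, e]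
          have := γ.nth_inj (by omega) (by omega) heq
          omega
      · have : k + 1 = γ.firstHitG := by omega
        rw [this, hfc_fh]; exact hrB
  exact key i hi1.le hi2

/-- Hence every face off the pocket other than `r` is avoided by the excursion.
[cite: Glazman2015WeightedSAW, Lemma 3.1 (proof: the classes of walks through a rhombus)] -/
theorem excursionAvoids_of_valve (hr : RootedFace D a r) (h : ω.IsB2a) {w c : Face} {B : Set Face}
    (huniq : ∀ f ∈ D, (∃ s, f.side s = a) → f = w) (hwB : w ∉ B) (hcw : c ≠ w) (hrB : r ∈ B)
    (s₁ s₂ : Side) (hdoors : ∀ s : Side, ((c.side s).faces.1 ∈ D ∧ (c.side s).faces.2 ∈ D) → s = s₁ ∨ s = s₂)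
    (hvalve : ∀ f ∈ B, ∀ g ∈ D, g ∉ B → (∃ s s', f.side s = g.side s') → g = c)
    {g : Face} (hg : g ∉ B) : ω.ExcursionAvoids g :=
  ⟨fun e => hg (e ▸ hrB), fun _ hi1 hi2 e =>
    hg (e ▸ fc_mem_pocket_of_valve hr h huniq hwB hcw hrB s₁ s₂ hdoors hvalve hi1 hi2)⟩

end ΩG

/-- ★★ **Pocket behind a valve is unwound.** In the situation of `ΩG.fc_mem_pocket_of_valve`, if the root
plaquette `w` is joined to a face beyond the domain by a king chain of faces OFF the pocket (faces of
`D ∖ B` or exterior faces, consecutive ones sharing a corner), then every rhombus `r` of the pocket is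
unwound: no excursion polygon at `r` winds around the midpoint of the root — although the root may be THICK
and walks reaching `r` may have circled the hole before entering the pocket.
[cite: GlazmanManolescu2019, Lemma 2.1 (statement, "in the form given in [Gl]")]
[cite: Glazman2015WeightedSAW, Lemma 3.1 (proof: the winding of the grouped walks)] -/
theorem unwoundAt_of_valve {w c : Face} {B : Set Face} (ha : ∃ s, w.side s = a)
    (huniq : ∀ f ∈ D, (∃ s, f.side s = a) → f = w) (hwB : w ∉ B) (hcw : c ≠ w) (hrB : r ∈ B)
    (s₁ s₂ : Side) (hdoors : ∀ s : Side, ((c.side s).faces.1 ∈ D ∧ (c.side s).faces.2 ∈ D) → s = s₁ ∨ s = s₂)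
    (hvalve : ∀ f ∈ B, ∀ g ∈ D, g ∉ B → (∃ s s', f.side s = g.side s') → g = c)
    {n : ℕ} {g : ℕ → Face} (hg0 : g 0 = w) (hoff : ∀ i ≤ n, g i ∉ B)
    (hlink : ∀ i < n, ∃ q : ℤ × ℤ, IsCornerOf q (g i) ∧ IsCornerOf q (g (i + 1))) (hD : g n ∉ D)
    (hb : (∀ f ∈ D, (g n).1 < f.1) ∨ (∀ f ∈ D, f.1 < (g n).1) ∨ (∀ f ∈ D, (g n).2 < f.2) ∨ (∀ f ∈ D, f.2 < (g n).2)) :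
    UnwoundAt D a r := by
  intro hr ω h
  exact ΩG.AJ_root_eq_zero_of_avoiding_chain hr h (g := g) (n := n) (hg0 ▸ ha)
    (fun i hi => ΩG.excursionAvoids_of_valve hr h huniq hwB hcw hrB s₁ s₂ hdoors hvalve (hoff i hi))
    hlink hD hb

/-! ### A region entered through a cut of at most two doors: the excursion stays inside -/

/-- A change point of a predicate along an interval of naturals. [cite: GlazmanManolescu2019, §1 (the lattice of rhombi and its mid-edges)] -/
private theorem exists_change {P : ℕ → Prop} {p q : ℕ} (hpq : p < q) (hp : ¬P p) (hq : P q) :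
    ∃ i, p < i ∧ i ≤ q ∧ ¬P (i - 1) ∧ P i := by
  induction q with
  | zero => omega
  | succ q ih =>
    by_cases hPq : P q
    · rcases Nat.lt_or_ge p q with hlt | hge
      · obtain ⟨i, h1, h2, h3, h4⟩ := ih hlt hPq
        exact ⟨i, h1, by omega, h3, h4⟩
      · have : p = q := by omega
        subst this; exact absurd hPq hp
    · exact ⟨q + 1, by omega, le_rfl, by simpa using hPq, hq⟩

/-- The same with the roles of `P` and `¬P` exchanged. [cite: GlazmanManolescu2019, §1 (the lattice of rhombi and its mid-edges)] -/
private theorem exists_change' {P : ℕ → Prop} {p q : ℕ} (hpq : p < q) (hp : P p) (hq : ¬P q) :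
    ∃ i, p < i ∧ i ≤ q ∧ P (i - 1) ∧ ¬P i := by
  obtain ⟨i, h1, h2, h3, h4⟩ := exists_change (P := fun k => ¬P k) hpq (not_not.2 hp) hq
  exact ⟨i, h1, h2, not_not.1 h3, h4⟩

namespace ΩG

variable {ω : ΩG D a r}

/-- **Two-door cut confinement.** Let the region `B ⊆ D` (more generally any set of faces) contain the rhombus
`r` but not the root plaquette `w` (the only face of `D` at the root `a`), and suppose that at most two
mid-edges `d₁, d₂` are doors between a face of `B` and a face of `D` off `B`. Then the excursion of every walk
of class `B2a` at `r` has all its arcs in faces of `B`. Indeed, mark each arc by whether its face lies in `B`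
(and the endpoint, on `∂r`, as in `B`): the marks change from «off» (first arc, in `w`) to «in» (the arc at the
first hit, in `r`), and would change to «off» and back to «in» again if an excursion arc left `B` — three
changes, each at a distinct crossed door of the cut, but there are only two.
[cite: Glazman2015WeightedSAW, Lemma 3.1 (proof: the classes of walks through a rhombus)] -/
theorem fc_mem_of_two_door_cut (hr : RootedFace D a r) (h : ω.IsB2a) {w : Face} {B : Set Face}
    (huniq : ∀ f ∈ D, (∃ s, f.side s = a) → f = w) (hwB : w ∉ B) (hrB : r ∈ B) (d₁ d₂ : MidEdge)
    (hcut : ∀ f ∈ B, ∀ g ∈ D, g ∉ B → ∀ s s', f.side s = g.side s' → f.side s = d₁ ∨ f.side s = d₂)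
    {i : ℕ} (hi1 : ω.2.firstHitG < i) (hi2 : i < ω.2.arcs.length) : ω.2.fc i ∈ B := by
  set γ := ω.2 with hγ
  set n := γ.arcs.length with hn
  have hfh : γ.firstHitG < n := ω.fh_lt h
  have hfc_fh : γ.fc γ.firstHitG = r := γ.fc_eq_of_arcFace_nth hfh (arcFace_firstHitG γ hr hfh)
  obtain ⟨h0in, -, -⟩ := γ.side_sIn_nth (i := 0) (by omega)
  rw [γ.nth_zero] at h0in
  have hfc0 : γ.fc 0 = w := huniq _ (YBWalk.arcFace_arcAt (γ := γ) (i := 0) (by omega)).2 ⟨_, h0in⟩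
  -- the marks: arc `k < n` is «in» iff its face lies in `B`; the endpoint `k = n` counts as «in»
  let P : ℕ → Prop := fun k => k = n ∨ γ.fc k ∈ B
  -- a change of mark at `k` (`1 ≤ k ≤ n`) happens at a door of the cut, namely `γ.nth k`
  have door_of_change : ∀ k, 1 ≤ k → k ≤ n → ((P (k - 1) ∧ ¬P k) ∨ (¬P (k - 1) ∧ P k)) →
      (γ.nth k = d₁ ∨ γ.nth k = d₂) := by
    intro k hk1 hkn hch
    have hPk1 : P (k - 1) ↔ γ.fc (k - 1) ∈ B := by
      constructor
      · rintro (e | e)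
        · omega
        · exact e
      · exact fun e => Or.inr e
    obtain ⟨-, hout, -⟩ := γ.side_sIn_nth (i := k - 1) (by omega)
    rw [show k - 1 + 1 = k by omega] at hout
    have hDk1 : γ.fc (k - 1) ∈ D := (YBWalk.arcFace_arcAt (γ := γ) (i := k - 1) (by omega)).2
    rcases Nat.lt_or_ge k n with hlt | hge
    · -- two arcs across `γ.nth k`
      have hPk : P k ↔ γ.fc k ∈ B := by
        constructor
        · rintro (e | e)
          · omega
          · exact e
        · exact fun e => Or.inr e
      obtain ⟨hin, -, -⟩ := γ.side_sIn_nth hlt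
      have hDk : γ.fc k ∈ D := (YBWalk.arcFace_arcAt (γ := γ) hlt).2
      rw [hPk1, hPk] at hch
      rcases hch with ⟨hb, hb'⟩ | ⟨hb, hb'⟩
      · have := hcut _ hb _ hDk hb' _ _ (hout.trans hin.symm)
        rwa [hout] at this
      · have := hcut _ hb' _ hDk1 hb _ _ (hin.trans hout.symm)
        rwa [hin] at this
    · -- the last arc and the endpoint on `∂r`
      have hk : k = n := by omega
      have hPk : P k := Or.inl hk
      rw [hPk1] at hch
      have hb : γ.fc (k - 1) ∉ B := by
        rcases hch with ⟨_, hb'⟩ | ⟨hb, _⟩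
        · exact absurd hPk hb'
        · exact hb
      rw [hk] at hout hb hDk1 ⊢
      rw [γ.nth_length] at hout ⊢
      exact hcut _ hrB _ hDk1 hb ω.1 _ hout.symm
  -- three changes of mark
  have hP0 : ¬P 0 := by
    rintro (e | e)
    · omega
    · exact hwB (hfc0 ▸ e)
  have hPfh : P γ.firstHitG := Or.inr (by rw [hfc_fh]; exact hrB)
  have hPn : P n := Or.inl rfl
  by_contra hiB
  have hPi : ¬P i := by
    rintro (e | e)
    · omega
    · exact hiB e
  have hfh0 : 0 < γ.firstHitG := by
    by_contra h0
    have e : γ.firstHitG = 0 := by omega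
    apply hwB
    rw [← hfc0, ← e, hfc_fh]
    exact hrB
  obtain ⟨i₁, h11, h12, h13, h14⟩ := exists_change (P := P) hfh0 hP0 hPfh
  obtain ⟨i₂, h21, h22, h23, h24⟩ := exists_change' (P := P) hi1 hPfh hPi
  obtain ⟨i₃, h31, h32, h33, h34⟩ := exists_change (P := P) hi2 hPi hPn
  have e1 := door_of_change i₁ (by omega) (by omega) (Or.inr ⟨h13, h14⟩)
  have e2 := door_of_change i₂ (by omega) (by omega) (Or.inl ⟨h23, h24⟩)
  have e3 := door_of_change i₃ (by omega) (by omega) (Or.inr ⟨h33, h34⟩)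
  have hl := γ.length_eq
  -- three distinct indices, two doors: two of the crossed mid-edges coincide
  rcases e1 with e1 | e1 <;> rcases e2 with e2 | e2 <;> rcases e3 with e3 | e3
  · have := γ.nth_inj (by omega) (by omega) (e1.trans e2.symm); omega
  · have := γ.nth_inj (by omega) (by omega) (e1.trans e2.symm); omega
  · have := γ.nth_inj (by omega) (by omega) (e1.trans e3.symm); omega
  · have := γ.nth_inj (by omega) (by omega) (e2.trans e3.symm); omega
  · have := γ.nth_inj (by omega) (by omega) (e2.trans e3.symm); omega
  · have := γ.nth_inj (by omega) (by omega) (e1.trans e3.symm); omega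
  · have := γ.nth_inj (by omega) (by omega) (e1.trans e2.symm); omega
  · have := γ.nth_inj (by omega) (by omega) (e1.trans e2.symm); omega

/-- Hence every face off the region other than `r` is avoided by the excursion.
[cite: Glazman2015WeightedSAW, Lemma 3.1 (proof: the classes of walks through a rhombus)] -/
theorem excursionAvoids_of_two_door_cut (hr : RootedFace D a r) (h : ω.IsB2a) {w : Face} {B : Set Face}
    (huniq : ∀ f ∈ D, (∃ s, f.side s = a) → f = w) (hwB : w ∉ B) (hrB : r ∈ B) (d₁ d₂ : MidEdge)
    (hcut : ∀ f ∈ B, ∀ g ∈ D, g ∉ B → ∀ s s', f.side s = g.side s' → f.side s = d₁ ∨ f.side s = d₂)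
    {g : Face} (hg : g ∉ B) : ω.ExcursionAvoids g :=
  ⟨fun e => hg (e ▸ hrB), fun _ hi1 hi2 e =>
    hg (e ▸ fc_mem_of_two_door_cut hr h huniq hwB hrB d₁ d₂ hcut hi1 hi2)⟩

end ΩG

/-- ★★★ **Confinement behind a two-door cut.** If the region `B ∌ w` of faces is separated from the rest of the
domain by at most two doors, and the root plaquette `w` is king-joined to a face beyond `D` through faces off
`B`, then every rhombus `r ∈ B` is unwound for the root `a` — whatever the root (outer, isthmus, thick).
[cite: GlazmanManolescu2019, Lemma 2.1 (statement, "in the form given in [Gl]")]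
[cite: Glazman2015WeightedSAW, Lemma 3.1 (proof: the winding of the grouped walks)] -/
theorem unwoundAt_of_two_door_cut {w : Face} {B : Set Face} (ha : ∃ s, w.side s = a)
    (huniq : ∀ f ∈ D, (∃ s, f.side s = a) → f = w) (hwB : w ∉ B) (hrB : r ∈ B) (d₁ d₂ : MidEdge)
    (hcut : ∀ f ∈ B, ∀ g ∈ D, g ∉ B → ∀ s s', f.side s = g.side s' → f.side s = d₁ ∨ f.side s = d₂)
    {n : ℕ} {g : ℕ → Face} (hg0 : g 0 = w) (hoff : ∀ i ≤ n, g i ∉ B)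
    (hlink : ∀ i < n, ∃ q : ℤ × ℤ, IsCornerOf q (g i) ∧ IsCornerOf q (g (i + 1))) (hD : g n ∉ D)
    (hb : (∀ f ∈ D, (g n).1 < f.1) ∨ (∀ f ∈ D, f.1 < (g n).1) ∨ (∀ f ∈ D, (g n).2 < f.2) ∨ (∀ f ∈ D, f.2 < (g n).2)) :
    UnwoundAt D a r := by
  intro hr ω h
  exact ΩG.AJ_root_eq_zero_of_avoiding_chain hr h (g := g) (n := n) (hg0 ▸ ha)
    (fun i hi => ΩG.excursionAvoids_of_two_door_cut hr h huniq hwB hrB d₁ d₂ hcut (hoff i hi)) hlink hD hb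


/-! ### Defect confinement: a two-door root plaquette on the outer rim -/

/-- **A two-door rim root is unwound at every other plaquette.** Let the root `a` be a side of the face
`w`, the only face of `D` at `a` (a hole root or an outer root), let at most two sides of `w` be doors of
`D`, and let `w` be joined to a face `g n ∉ D` beyond the domain by a king chain `g 1, …, g n` of faces
outside `D` (consecutive faces, and `w`, `g 1`, sharing a corner). Then no excursion polygon at any
rhombus `r ≠ w` winds around the midpoint of `a`: `UnwoundAt D a r`.
[cite: GlazmanManolescu2019, Lemma 2.1 (statement, "in the form given in [Gl]")]
[cite: Glazman2015WeightedSAW, Lemma 3.1 (proof: the winding of the grouped walks)] -/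
theorem unwoundAt_of_two_door_rim_root {w : Face} (ha : ∃ s, w.side s = a)
    (huniq : ∀ f ∈ D, (∃ s, f.side s = a) → f = w) (s₁ s₂ : Side)
    (hdoors : ∀ s : Side, ((w.side s).faces.1 ∈ D ∧ (w.side s).faces.2 ∈ D) → s = s₁ ∨ s = s₂)
    {n : ℕ} {g : ℕ → Face} (hg0 : g 0 = w) (hout : ∀ i, 1 ≤ i → i ≤ n → g i ∉ D)
    (hlink : ∀ i < n, ∃ q : ℤ × ℤ, IsCornerOf q (g i) ∧ IsCornerOf q (g (i + 1))) (hn : 1 ≤ n)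
    (hb : (∀ f ∈ D, (g n).1 < f.1) ∨ (∀ f ∈ D, f.1 < (g n).1) ∨ (∀ f ∈ D, (g n).2 < f.2) ∨ (∀ f ∈ D, f.2 < (g n).2))
    (hwr : w ≠ r) : UnwoundAt D a r := by
  intro hr ω h
  refine ΩG.AJ_root_eq_zero_of_avoiding_chain hr h (g := g) (n := n) (hg0 ▸ ha) (fun i hi => ?_) hlink
    (hout n hn le_rfl) hb
  rcases Nat.eq_zero_or_pos i with rfl | hi0
  · rw [hg0]; exact ΩG.excursionAvoids_root_face_of_two_doors hr huniq hwr s₁ s₂ hdoors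
  · exact ΩG.excursionAvoids_of_not_mem hr (hout i hi0 hi)

end Literature.Probability.RandomPlanarGeometry.SAW.YangBaxter

namespace Literature.Barriers.CriticalPhenomena.PlaquetteWalk

open Literature.Probability.RandomPlanarGeometry.SAW
open Literature.Probability.RandomPlanarGeometry.SAW.YangBaxter

/-- ★★ **Defect confinement to the root plaquette.** For the printed Yang–Baxter weights at any
`θ ∈ [π/3, 2π/3]`, a finite face list `Dl`, and a root `a` whose unique plaquette `w ∈ Dl` has at most two
doors and lies on the outer rim (king-joined through faces outside `Dl` to a face beyond `Dl`): the vertex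
functional vanishes at EVERY face `f₀ ≠ w` — any defect of the hole root sits at the root plaquette itself.
[cite: GlazmanManolescu2019, Lemma 2.1, eq. (2.2) (CR)] [cite: DuminilCopinSmirnov2012, proof of Lemma 1] -/
theorem vertexFunctional_printed_eq_zero_of_two_door_rim_root {θ : ℝ} (hθ : θ ∈ Set.Icc (π / 3) (2 * π / 3))
    (Dl : List Face) (a : MidEdge) {w : Face} (ha : ∃ s, w.side s = a)
    (huniq : ∀ f ∈ Dl, (∃ s, f.side s = a) → f = w) (s₁ s₂ : Side)
    (hdoors : ∀ s : Side, ((w.side s).faces.1 ∈ Dl ∧ (w.side s).faces.2 ∈ Dl) → s = s₁ ∨ s = s₂)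
    {n : ℕ} {g : ℕ → Face} (hg0 : g 0 = w) (hout : ∀ i, 1 ≤ i → i ≤ n → g i ∉ Dl)
    (hlink : ∀ i < n, ∃ q : ℤ × ℤ, IsCornerOf q (g i) ∧ IsCornerOf q (g (i + 1))) (hn : 1 ≤ n)
    (hb : (∀ f ∈ Dl, (g n).1 < f.1) ∨ (∀ f ∈ Dl, f.1 < (g n).1) ∨ (∀ f ∈ Dl, (g n).2 < f.2) ∨ (∀ f ∈ Dl, f.2 < (g n).2))
    {f₀ : Face} (hf : f₀ ∈ Dl) (hfw : f₀ ≠ w) :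
    vertexFunctional (printedWeights θ) tFiveEighths (ybCoeff θ) Dl a f₀ = 0 := by
  obtain ⟨σ, hσ⟩ := ha
  have hroot : ¬(a.faces.1 ∈ dom Dl ∧ a.faces.2 ∈ dom Dl) := by
    rintro ⟨h1, h2⟩
    -- both faces of `a` would be faces of `Dl` having `a` as a side, hence both `= w`
    have e1 := huniq _ h1 ((Face.exists_side_eq_iff _ a).2 (Or.inl rfl))
    have e2 := huniq _ h2 ((Face.exists_side_eq_iff _ a).2 (Or.inr rfl))
    have hne : a.faces.1 ≠ a.faces.2 := by
      cases a <;> simp [MidEdge.faces]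
    exact hne (e1.trans e2.symm)
  refine vertexFunctional_printed_eq_zero_of_unwoundAt hθ Dl a hroot f₀ hf ?_
  exact unwoundAt_of_two_door_rim_root (D := dom Dl) ⟨σ, hσ⟩ (fun f hf' hs => huniq f hf' hs) s₁ s₂
    (fun s hs => hdoors s hs) hg0 (fun i h1 h2 => hout i h1 h2) hlink hn hb hfw.symm

/-! ### The vertex relation inside a pocket behind a valve (thick roots included) -/

/-- The root is non-interior when its plaquette `w` is the only face of the domain at it. [cite: GlazmanManolescu2019, §2.1 (walks start on the boundary of the domain)] -/
theorem root_not_interior_of_unique (Dl : List Face) (a : MidEdge) {w : Face}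
    (huniq : ∀ f ∈ Dl, (∃ s, f.side s = a) → f = w) : ¬(a.faces.1 ∈ dom Dl ∧ a.faces.2 ∈ dom Dl) := by
  rintro ⟨h1, h2⟩
  have e1 := huniq _ h1 ((Face.exists_side_eq_iff _ a).2 (Or.inl rfl))
  have e2 := huniq _ h2 ((Face.exists_side_eq_iff _ a).2 (Or.inr rfl))
  have hne : a.faces.1 ≠ a.faces.2 := by
    cases a <;> simp [MidEdge.faces]
  exact hne (e1.trans e2.symm)

/-- ★★ **The vertex relation holds throughout a pocket behind a two-door valve, for ANY boundary root off
the pocket** — outer, isthmus or THICK hole root: if the faces of `Dl` in the pocket `B` touch the rest of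
`Dl` only along the valve face `c` (at most two doors), and the root plaquette `w ∉ B` is king-joined to a
face beyond `Dl` through faces off the pocket, then the printed Yang–Baxter weights satisfy the vertex
relation at every `f₀ ∈ B`, for every `θ ∈ [π/3, 2π/3]`. (Walks reaching the pocket may well have circled
the hole of the root; their excursions from `f₀` cannot, the valve being sealed by the prefix.)
[cite: GlazmanManolescu2019, Lemma 2.1, eq. (2.2) (CR)] [cite: DuminilCopinSmirnov2012, proof of Lemma 1] -/
theorem vertexFunctional_printed_eq_zero_of_valve {θ : ℝ} (hθ : θ ∈ Set.Icc (π / 3) (2 * π / 3))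
    (Dl : List Face) (a : MidEdge) {w c : Face} (B : Set Face) (ha : ∃ s, w.side s = a)
    (huniq : ∀ f ∈ Dl, (∃ s, f.side s = a) → f = w) (hwB : w ∉ B) (hcw : c ≠ w) (s₁ s₂ : Side)
    (hdoors : ∀ s : Side, ((c.side s).faces.1 ∈ Dl ∧ (c.side s).faces.2 ∈ Dl) → s = s₁ ∨ s = s₂)
    (hvalve : ∀ f ∈ B, ∀ g ∈ Dl, g ∉ B → (∃ s s', f.side s = g.side s') → g = c)
    {n : ℕ} {g : ℕ → Face} (hg0 : g 0 = w) (hoff : ∀ i ≤ n, g i ∉ B)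
    (hlink : ∀ i < n, ∃ q : ℤ × ℤ, IsCornerOf q (g i) ∧ IsCornerOf q (g (i + 1))) (hD : g n ∉ Dl)
    (hb : (∀ f ∈ Dl, (g n).1 < f.1) ∨ (∀ f ∈ Dl, f.1 < (g n).1) ∨ (∀ f ∈ Dl, (g n).2 < f.2) ∨ (∀ f ∈ Dl, f.2 < (g n).2))
    {f₀ : Face} (hf : f₀ ∈ Dl) (hfB : f₀ ∈ B) :
    vertexFunctional (printedWeights θ) tFiveEighths (ybCoeff θ) Dl a f₀ = 0 := by
  refine vertexFunctional_printed_eq_zero_of_unwoundAt hθ Dl a (root_not_interior_of_unique Dl a huniq) f₀ hf ?_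
  exact unwoundAt_of_valve (D := dom Dl) ha (fun f hf' hs => huniq f hf' hs) hwB hcw hfB s₁ s₂
    (fun s hs => hdoors s hs) (fun f hf' g' hg' hgB hadj => hvalve f hf' g' hg' hgB hadj) hg0 hoff hlink hD hb

/-! #### The lane's `pendant` domain: a `2 × 3` block behind a width-one corridor of a holed `4 × 3` box -/

/-- The venture lane's `pendant` domain: the box `4 × 3` minus `(1, 1)`, the corridor cell `(4, 1)` and the
block `{5, 6} × {0, 1, 2}`. [cite: GlazmanManolescu2019, §2.1 (finite domains of faces)] -/
def pendant : List Face :=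
  [(0, 0), (0, 1), (0, 2), (1, 0), (1, 2), (2, 0), (2, 1), (2, 2), (3, 0), (3, 1), (3, 2), (4, 1),
    (5, 0), (5, 1), (5, 2), (6, 0), (6, 1), (6, 2)]

/-- Its block behind the corridor. [cite: GlazmanManolescu2019, §2.1 (finite domains of faces)] -/
def pendantBlock : List Face := [(5, 0), (5, 1), (5, 2), (6, 0), (6, 1), (6, 2)]

/-- ★★ **A non-vacuous zero of a THICK hole root, proved**: in `pendant`, rooted at the `W` side of `(2, 1)`
(the hole `(1, 1)` behind the root, the plaquette `(3, 1)` across the opposite side INSIDE the domain — a thick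
root, where the identity fails at `(2,0), (2,1), (2,2), (3,1)`), the vertex relation holds at all six block
plaquettes behind the corridor `(4, 1)` — including `(5, 1)` (four doors) and `(6, 1)` (three doors), which
DO carry excursions — for every `θ ∈ [π/3, 2π/3]` (lane data: exact zeros at `θ = π/3, π/2, 2π/3`).
[cite: GlazmanManolescu2019, Lemma 2.1, eq. (2.2) (CR)] -/
theorem vertexFunctional_printed_pendant_block_eq_zero {θ : ℝ} (hθ : θ ∈ Set.Icc (π / 3) (2 * π / 3))
    {f₀ : Face} (hf : f₀ ∈ pendantBlock) :
    vertexFunctional (printedWeights θ) tFiveEighths (ybCoeff θ) pendant (Face.side (2, 1) .W) f₀ = 0 := by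
  have hval : ∀ f ∈ pendantBlock, ∀ g ∈ pendant, g ∉ pendantBlock → (∃ s s', f.side s = g.side s') →
      g = ((4 : ℤ), (1 : ℤ)) := by
    decide
  have hsub : ∀ f ∈ pendantBlock, f ∈ pendant := by decide
  refine vertexFunctional_printed_eq_zero_of_valve hθ pendant (Face.side (2, 1) .W) (w := (2, 1)) (c := (4, 1))
    {f | f ∈ pendantBlock} ⟨.W, rfl⟩ ?_ (by decide) (by decide) .W .E ?_
    (fun f hf' g hg hgB hadj => hval f hf' g hg hgB hadj) (n := 2) (g := fun i => ((2 : ℤ), (1 : ℤ) + i)) rfl ?_ ?_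
    (by decide) ?_ (hsub f₀ hf) hf
  · intro f hf' hs
    rcases (Face.exists_side_eq_iff f _).1 hs with e | e
    · exfalso; rw [e] at hf'; revert hf'; decide
    · rw [e]; rfl
  · intro s hs
    rcases s with _ | _ | _ | _
    · exact Or.inl rfl
    · exact Or.inr rfl
    · exfalso; revert hs; decide
    · exfalso; revert hs; decide
  · intro i hi
    interval_cases i <;> decide
  · intro i hi
    interval_cases i
    · exact ⟨(2, 2), ⟨Or.inl rfl, Or.inr rfl⟩, ⟨Or.inl rfl, Or.inl rfl⟩⟩
    · exact ⟨(2, 3), ⟨Or.inl rfl, Or.inr rfl⟩, ⟨Or.inl rfl, Or.inl rfl⟩⟩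
  · right; right; right
    decide

/-! ### The vertex relation behind a two-door cut; a width-two neck -/

/-- ★★★ **The vertex relation holds throughout a region cut off by at most two doors, for ANY boundary root
off the region**: if at most two mid-edges are doors between the faces of `B ∌ w` and the other faces of `Dl`,
and the root plaquette `w` is king-joined to a face beyond `Dl` through faces off `B`, then the printed
Yang–Baxter weights satisfy the vertex relation at every `f₀ ∈ B`, for every `θ ∈ [π/3, 2π/3]` — the root may be
an outer root, an isthmus hole root or a THICK hole root, and the walks reaching `B` may have circled its hole.
[cite: GlazmanManolescu2019, Lemma 2.1, eq. (2.2) (CR)] [cite: DuminilCopinSmirnov2012, proof of Lemma 1] -/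
theorem vertexFunctional_printed_eq_zero_of_two_door_cut {θ : ℝ} (hθ : θ ∈ Set.Icc (π / 3) (2 * π / 3))
    (Dl : List Face) (a : MidEdge) {w : Face} (B : Set Face) (ha : ∃ s, w.side s = a)
    (huniq : ∀ f ∈ Dl, (∃ s, f.side s = a) → f = w) (hwB : w ∉ B) (d₁ d₂ : MidEdge)
    (hcut : ∀ f ∈ B, ∀ g ∈ Dl, g ∉ B → ∀ s s', f.side s = g.side s' → f.side s = d₁ ∨ f.side s = d₂)
    {n : ℕ} {g : ℕ → Face} (hg0 : g 0 = w) (hoff : ∀ i ≤ n, g i ∉ B)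
    (hlink : ∀ i < n, ∃ q : ℤ × ℤ, IsCornerOf q (g i) ∧ IsCornerOf q (g (i + 1))) (hD : g n ∉ Dl)
    (hb : (∀ f ∈ Dl, (g n).1 < f.1) ∨ (∀ f ∈ Dl, f.1 < (g n).1) ∨ (∀ f ∈ Dl, (g n).2 < f.2) ∨ (∀ f ∈ Dl, f.2 < (g n).2))
    {f₀ : Face} (hf : f₀ ∈ Dl) (hfB : f₀ ∈ B) :
    vertexFunctional (printedWeights θ) tFiveEighths (ybCoeff θ) Dl a f₀ = 0 := by
  refine vertexFunctional_printed_eq_zero_of_unwoundAt hθ Dl a (root_not_interior_of_unique Dl a huniq) f₀ hf ?_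
  exact unwoundAt_of_two_door_cut (D := dom Dl) ha (fun f hf' hs => huniq f hf' hs) hwB hfB d₁ d₂
    (fun f hf' g' hg' hgB s s' e => hcut f hf' g' hg' hgB s s' e) hg0 hoff hlink hD hb

/-! #### A width-two neck: the thick ring `5 × 5 ∖ (2,2)` with a `2 × 3` block attached through two cells -/

/-- The venture lane's `neck` domain: the box `5 × 5` minus `(2, 2)` (every hole root thick), the two neck cells
`(5, 2), (5, 3)` and the block `{6, 7} × {1, 2, 3}`. [cite: GlazmanManolescu2019, §2.1 (finite domains of faces)] -/
def neck : List Face :=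
  [(0, 0), (0, 1), (0, 2), (0, 3), (0, 4), (1, 0), (1, 1), (1, 2), (1, 3), (1, 4), (2, 0), (2, 1), (2, 3), (2, 4),
    (3, 0), (3, 1), (3, 2), (3, 3), (3, 4), (4, 0), (4, 1), (4, 2), (4, 3), (4, 4), (5, 2), (5, 3),
    (6, 1), (6, 2), (6, 3), (7, 1), (7, 2), (7, 3)]

/-- The region behind the neck: neck cells and block. [cite: GlazmanManolescu2019, §2.1 (finite domains of faces)] -/
def neckRegion : List Face := [(5, 2), (5, 3), (6, 1), (6, 2), (6, 3), (7, 1), (7, 2), (7, 3)]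

/-- ★★★ **A width-TWO neck still confines**: in `neck`, rooted at the THICK hole root `W` side of `(3, 2)`
(ring of width two all around the hole `(2, 2)`), the region behind the two-cell neck is entered through the two
doors `(4,2)|(5,2)` and `(4,3)|(5,3)` only; the vertex relation holds at all eight of its plaquettes, for every
`θ ∈ [π/3, 2π/3]` (lane data at `θ = π/2`: exact zeros there, with walks that wind twice around the hole before
entering; 20 of the 24 ring plaquettes fail). [cite: GlazmanManolescu2019, Lemma 2.1, eq. (2.2) (CR)] -/
theorem vertexFunctional_printed_neck_region_eq_zero {θ : ℝ} (hθ : θ ∈ Set.Icc (π / 3) (2 * π / 3))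
    {f₀ : Face} (hf : f₀ ∈ neckRegion) :
    vertexFunctional (printedWeights θ) tFiveEighths (ybCoeff θ) neck (Face.side (3, 2) .W) f₀ = 0 := by
  have hcut' : ∀ f ∈ neckRegion, ∀ g ∈ neck, g ∉ neckRegion → ∀ s s', f.side s = g.side s' →
      f.side s = MidEdge.vert 5 2 ∨ f.side s = MidEdge.vert 5 3 := by
    decide
  have hsub : ∀ f ∈ neckRegion, f ∈ neck := by decide
  refine vertexFunctional_printed_eq_zero_of_two_door_cut hθ neck (Face.side (3, 2) .W) (w := (3, 2))
    {f | f ∈ neckRegion} ⟨.W, rfl⟩ ?_ (by decide) (MidEdge.vert 5 2) (MidEdge.vert 5 3)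
    (fun f hf' g hg hgB s s' e => hcut' f hf' g hg hgB s s' e) (n := 3) (g := fun i => ((3 : ℤ), (2 : ℤ) + i)) rfl
    ?_ ?_ (by decide) ?_ (hsub f₀ hf) hf
  · intro f hf' hs
    rcases (Face.exists_side_eq_iff f _).1 hs with e | e
    · exfalso; rw [e] at hf'; revert hf'; decide
    · rw [e]; rfl
  · intro i hi
    interval_cases i <;> decide
  · intro i hi
    interval_cases i
    · exact ⟨(3, 3), ⟨Or.inl rfl, Or.inr rfl⟩, ⟨Or.inl rfl, Or.inl rfl⟩⟩
    · exact ⟨(3, 4), ⟨Or.inl rfl, Or.inr rfl⟩, ⟨Or.inl rfl, Or.inl rfl⟩⟩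
    · exact ⟨(3, 5), ⟨Or.inl rfl, Or.inr rfl⟩, ⟨Or.inl rfl, Or.inl rfl⟩⟩
  · right; right; right
    decide

/-! ### Single-hole boxes rooted on the hole, root plaquette on the top row -/

/-- **The `m × n` box with the face `h` removed** (`0 ≤ i < m`, `0 ≤ j < n`, `(i, j) ≠ h`), listed
column by column. [cite: GlazmanManolescu2019, §2.1 (finite domains of faces)] -/
def holedBox (m n : ℕ) (h : Face) : List Face :=
  ((List.range m).flatMap fun i => (List.range n).map fun j => (((i : ℕ) : ℤ), ((j : ℕ) : ℤ))).filter
    fun f => decide (f ≠ h)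

/-- Membership in the holed box. [cite: GlazmanManolescu2019, §2.1 (finite domains of faces)] -/
theorem mem_holedBox {m n : ℕ} {h f : Face} :
    f ∈ holedBox m n h ↔ 0 ≤ f.1 ∧ f.1 < m ∧ 0 ≤ f.2 ∧ f.2 < n ∧ f ≠ h := by
  obtain ⟨x, y⟩ := f
  simp only [holedBox, List.mem_filter, List.mem_flatMap, List.mem_range, List.mem_map, Prod.mk.injEq,
    decide_eq_true_eq, ne_eq]
  constructor
  · rintro ⟨⟨i, hi, j, hj, rfl, rfl⟩, hne⟩
    exact ⟨by omega, by omega, by omega, by omega, hne⟩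
  · rintro ⟨h1, h2, h3, h4, hne⟩
    exact ⟨⟨x.toNat, by omega, y.toNat, by omega, by omega, by omega⟩, hne⟩

/-- ★★ **Thin-ring defect confinement (top-row root).** In the box `m × n` minus the hole `h`, rooted at
the `N` side of the hole, suppose the root plaquette `w = (h.1, h.2 + 1)` lies on the TOP ROW
(`h.2 + 2 = n`): its `N` side faces the outside and its `S` side the hole, so `w` has at most the two doors
`W`, `E`. Then for every `θ ∈ [π/3, 2π/3]` the printed Yang–Baxter weights satisfy the vertex relation at
EVERY face of the box other than `w` — whatever `m`, `h.1` and the shape of the rest of the ring (the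
lane's far-cell «vacuous zeros» on thin rings are the case `f₀ = (h.1, h.2 - 1)`).
[cite: GlazmanManolescu2019, Lemma 2.1, eq. (2.2) (CR)] [cite: DuminilCopinSmirnov2012, proof of Lemma 1] -/
theorem vertexFunctional_printed_holedBox_topRow_eq_zero {θ : ℝ} (hθ : θ ∈ Set.Icc (π / 3) (2 * π / 3))
    (m n : ℕ) (h : Face) (hn : h.2 + 2 = n) {f₀ : Face} (hf : f₀ ∈ holedBox m n h)
    (hfw : f₀ ≠ (h.1, h.2 + 1)) :
    vertexFunctional (printedWeights θ) tFiveEighths (ybCoeff θ) (holedBox m n h) (Face.side h .N) f₀ = 0 := by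
  have hN : Face.side h .N = Face.side (h.1, h.2 + 1) .S := by
    simp only [Face.side]
  refine vertexFunctional_printed_eq_zero_of_two_door_rim_root hθ (holedBox m n h) (Face.side h .N)
    (w := (h.1, h.2 + 1)) ⟨.S, hN.symm⟩ ?_ .W .E ?_ (n := 1) (g := fun i => (h.1, h.2 + 1 + i)) ?_ ?_ ?_ le_rfl
    ?_ hf hfw
  · -- `w` is the only face of the box at the root (the other one is the hole)
    intro f hf' hs
    rcases (Face.exists_side_eq_iff f _).1 hs with e | e
    · exfalso
      rw [mem_holedBox] at hf'
      apply hf'.2.2.2.2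
      rw [e]; simp [Face.side, MidEdge.faces]
    · rw [e]; simp [Face.side, MidEdge.faces]
  · -- the doors of `w` are among `W`, `E`: `N` leads outside, `S` into the hole
    intro s hs
    rcases s with _ | _ | _ | _
    · exact Or.inl rfl
    · exact Or.inr rfl
    · exfalso
      obtain ⟨h1, -⟩ := hs
      rw [mem_holedBox] at h1
      apply h1.2.2.2.2
      simp [Face.side, MidEdge.faces]
    · exfalso
      obtain ⟨-, h2⟩ := hs
      rw [mem_holedBox] at h2
      simp [Face.side, MidEdge.faces] at h2
      omega
  · simp
  · intro i h1 h2
    have hi : i = 1 := by omega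
    subst hi
    rw [mem_holedBox]
    simp only [not_and]
    intro _ _ _ h4
    omega
  · intro i hi
    have hi' : i = 0 := by omega
    subst hi'
    exact ⟨(h.1, h.2 + 2), ⟨Or.inl rfl, Or.inr (by simp; ring)⟩, ⟨Or.inl rfl, Or.inl (by simp; ring)⟩⟩
  · right; right; right
    intro f hf'
    rw [mem_holedBox] at hf'
    simp only
    omega

/-- ★ **The far cell across the hole** (`(h.1, h.2 - 1)`, the lane's (R-9) cell) of a top-row root: the
vertex relation holds there for every `θ ∈ [π/3, 2π/3]` and every `m`, `n = h.2 + 2`, `h.1`.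
[cite: GlazmanManolescu2019, Lemma 2.1, eq. (2.2) (CR)] -/
theorem vertexFunctional_printed_holedBox_topRow_farCell_eq_zero {θ : ℝ} (hθ : θ ∈ Set.Icc (π / 3) (2 * π / 3))
    (m n : ℕ) (h : Face) (hn : h.2 + 2 = n) (hfar : ((h.1, h.2 - 1) : Face) ∈ holedBox m n h) :
    vertexFunctional (printedWeights θ) tFiveEighths (ybCoeff θ) (holedBox m n h) (Face.side h .N) (h.1, h.2 - 1) = 0 :=
  vertexFunctional_printed_holedBox_topRow_eq_zero hθ m n h hn hfar (by
    intro e; have := congrArg Prod.snd e; simp at this; omega)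

end Literature.Barriers.CriticalPhenomena.PlaquetteWalk

namespace Literature.Barriers.CriticalPhenomena

open Literature.Probability.RandomPlanarGeometry.SAW
open Literature.Probability.RandomPlanarGeometry.SAW.YangBaxter
open Real

/-- **Named statement (venture lane «pcv-sawmu», thin-ring defect confinement)**: in every single-hole box
whose hole lies one row below the top row, rooted at the `N` side of the hole, the printed Yang–Baxter weights
satisfy the vertex relation at every plaquette other than the root plaquette, for every `θ ∈ [π/3, 2π/3]`.
[cite: GlazmanManolescu2019, Lemma 2.1, eq. (2.2) (CR)] [cite: DuminilCopinSmirnov2012, proof of Lemma 1] -/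
def PlaquetteWalkThinRingConfinement : Prop :=
  ∀ ⦃θ : ℝ⦄, θ ∈ Set.Icc (π / 3) (2 * π / 3) → ∀ (m n : ℕ) (h : Face), h.2 + 2 = n →
    ∀ ⦃f₀ : Face⦄, f₀ ∈ PlaquetteWalk.holedBox m n h → f₀ ≠ (h.1, h.2 + 1) →
      PlaquetteWalk.vertexFunctional (PlaquetteWalk.printedWeights θ) PlaquetteWalk.tFiveEighths (PlaquetteWalk.ybCoeff θ)
        (PlaquetteWalk.holedBox m n h) (Face.side h .N) f₀ = 0

/-- `PlaquetteWalkThinRingConfinement` holds. [cite: GlazmanManolescu2019, Lemma 2.1, eq. (2.2) (CR)] -/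
theorem PlaquetteWalkThinRingConfinement_holds : PlaquetteWalkThinRingConfinement :=
  fun _ hθ m n h hn _ hf hfw => PlaquetteWalk.vertexFunctional_printed_holedBox_topRow_eq_zero hθ m n h hn hf hfw

/-- **Named statement (venture lane «pcv-sawmu», pocket confinement at a thick hole root)**: in the lane's
`pendant` domain rooted at the thick hole root `W` side of `(2, 1)`, the printed Yang–Baxter weights satisfy the
vertex relation at every plaquette of the block behind the corridor, for every `θ ∈ [π/3, 2π/3]`.
[cite: GlazmanManolescu2019, Lemma 2.1, eq. (2.2) (CR)] [cite: DuminilCopinSmirnov2012, proof of Lemma 1] -/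
def PlaquetteWalkPocketConfinement : Prop :=
  ∀ ⦃θ : ℝ⦄, θ ∈ Set.Icc (π / 3) (2 * π / 3) → ∀ ⦃f₀ : Face⦄, f₀ ∈ PlaquetteWalk.pendantBlock →
    PlaquetteWalk.vertexFunctional (PlaquetteWalk.printedWeights θ) PlaquetteWalk.tFiveEighths (PlaquetteWalk.ybCoeff θ)
      PlaquetteWalk.pendant (Face.side (2, 1) .W) f₀ = 0

/-- `PlaquetteWalkPocketConfinement` holds. [cite: GlazmanManolescu2019, Lemma 2.1, eq. (2.2) (CR)] -/
theorem PlaquetteWalkPocketConfinement_holds : PlaquetteWalkPocketConfinement :=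
  fun _ hθ _ hf => PlaquetteWalk.vertexFunctional_printed_pendant_block_eq_zero hθ hf

end Literature.Barriers.CriticalPhenomena

/-! ## Appendix (edition 4): the same zeros on the whole complexified Yang–Baxter curve, at every admissible spin

The statements above are proved for the printed weights `W(θ)`, `θ ∈ [π/3, 2π/3]`, at the spin
`t = e^{−5iπ/16}`. For FIXED `(Dl, a, f₀)` the vertex functional of the curve point `ybCurve (−1) t r` with
the coefficients `(1, r, −1, −r)` is a rational function of `r` (`PlaquetteWalkYBCurveIdentity`), and the
printed arc `r(θ)` is infinite: so a zero for every printed `θ` is a zero on the whole curve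
(`vertexFunctional_ybCurve_eq_zero_of_printed`), and then at every spin `t` with `t¹⁶ = −1` by the lane's
spin transfer (`vertexFunctional_ybCurve_transfer` of `PlaquetteWalkYBIdentityIsthmusAllSpins`). Both steps are
pointwise in `(Dl, a, f₀)`, so every confinement zero of this file holds on the whole curve at all sixteen
spins — in particular the two-door-cut zeros (`vertexFunctional_ybCurve_eq_zero_of_two_door_cut_of_pow_sixteen`). -/

namespace Literature.Barriers.CriticalPhenomena.PlaquetteWalk

open Literature.Probability.RandomPlanarGeometry.SAW
open Literature.Probability.RandomPlanarGeometry.SAW.YangBaxter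
open Real Complex

open private ybDenPoly ybDenPoly_ne_zero isPolyOver_vertexFunctional printedArc_infinite eq_zero_of_infinite
  from Literature.Barriers.CriticalPhenomena.PlaquetteWalkYBCurveIdentity

/-- ★ **Printed arc ⇒ whole curve, pointwise.** If for fixed `(Dl, a, f₀)` the vertex functional of the
printed weights vanishes for every `θ ∈ [π/3, 2π/3]`, then the functional of `ybCurve (−1) t r` with
`(1, r, −1, −r)`, `t = e^{−5iπ/16}`, vanishes at every `r ≠ 0` off the curve's denominator — whatever the root.
[cite: GlazmanManolescu2019, eq. (1) and Lemma 2.1] [cite: Glazman2015WeightedSAW, Lemma 3.1 (the σ = 5/8 family)] -/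
theorem vertexFunctional_ybCurve_eq_zero_of_printed (Dl : List Face) (a : MidEdge) (f₀ : Face)
    (h : ∀ θ ∈ Set.Icc (π / 3) (2 * π / 3),
      vertexFunctional (printedWeights θ) tFiveEighths (ybCoeff θ) Dl a f₀ = 0)
    {r : ℂ} (hr : r ≠ 0) (hD : tFiveEighths ^ 6 * (1 + r ^ 4) - (1 + tFiveEighths ^ 12) * r ^ 2 ≠ 0) :
    vertexFunctional (ybCurve (-1) tFiveEighths r) tFiveEighths (oddCoeff r) Dl a f₀ = 0 := by
  have hS : ((ybRatio '' Set.Icc (π / 3) (2 * π / 3)) \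
      {x | (ybDenPoly tFiveEighths).IsRoot x}).Infinite :=
    printedArc_infinite.sdiff (Polynomial.finite_setOf_isRoot (ybDenPoly_ne_zero tFiveEighths_ne_zero))
  have hSQ : ∀ x ∈ (ybRatio '' Set.Icc (π / 3) (2 * π / 3)) \ {x | (ybDenPoly tFiveEighths).IsRoot x},
      (ybDenPoly tFiveEighths).eval x ≠ 0 := fun x hx => hx.2
  have hS0 : ∀ x ∈ (ybRatio '' Set.Icc (π / 3) (2 * π / 3)) \ {x | (ybDenPoly tFiveEighths).IsRoot x},
      vertexFunctional (ybCurve (-1) tFiveEighths x) tFiveEighths (oddCoeff x) Dl a f₀ = 0 := by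
    rintro x ⟨⟨θ, hθ, rfl⟩, -⟩
    rw [← printedWeights_eq_ybCurve θ (weightDen_ne_zero_of_mem hθ), oddCoeff_ybRatio]
    exact h θ hθ
  exact eq_zero_of_infinite (isPolyOver_vertexFunctional (-1) tFiveEighths Dl a f₀) hS hSQ hS0
    ((eval_ybDenPoly_ne_zero_iff' r).2 ⟨hr, hD⟩)
where
  /-- `Q_t(r) ≠ 0` iff `r ≠ 0` and the curve's denominator is nonzero (evaluation of the cleared
  denominator). [cite: GlazmanManolescu2019, eq. (1)] -/
  eval_ybDenPoly_ne_zero_iff' (r : ℂ) :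
      (ybDenPoly tFiveEighths).eval r ≠ 0 ↔ r ≠ 0 ∧ tFiveEighths ^ 6 * (1 + r ^ 4) - (1 + tFiveEighths ^ 12) * r ^ 2 ≠ 0 := by
    have : (ybDenPoly tFiveEighths).eval r = r * (tFiveEighths ^ 6 * (1 + r ^ 4) - (1 + tFiveEighths ^ 12) * r ^ 2) := by
      simp [ybDenPoly]
    rw [this, mul_ne_zero_iff]

/-- ★ **Printed arc ⇒ every admissible spin, pointwise**: under the same hypothesis the functional of
`ybCurve (−1) t r` vanishes for every `t` with `t¹⁶ = −1` and every `r ≠ 0` off the denominator at `t`.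
[cite: Glazman2015WeightedSAW, Lemma 3.1 (the σ = ℓ/8 families)] [cite: GlazmanManolescu2019, Lemma 2.1] -/
theorem vertexFunctional_ybCurve_eq_zero_of_printed_of_pow_sixteen (Dl : List Face) (a : MidEdge) (f₀ : Face)
    (h : ∀ θ ∈ Set.Icc (π / 3) (2 * π / 3),
      vertexFunctional (printedWeights θ) tFiveEighths (ybCoeff θ) Dl a f₀ = 0)
    {t : ℂ} (h16 : t ^ 16 = -1) {r : ℂ} (hr : r ≠ 0) (hD : t ^ 6 * (1 + r ^ 4) - (1 + t ^ 12) * r ^ 2 ≠ 0) :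
    vertexFunctional (ybCurve (-1) t r) t (oddCoeff r) Dl a f₀ = 0 :=
  vertexFunctional_ybCurve_transfer Dl a f₀ tFiveEighths_pow_sixteen h16
    (fun _ hx0 hxD => vertexFunctional_ybCurve_eq_zero_of_printed Dl a f₀ h hx0 hxD) hr hD

/-- ★★★ **Two-door-cut confinement on the whole curve, at all sixteen spins.** In the situation of
`vertexFunctional_printed_eq_zero_of_two_door_cut` the functional of `ybCurve (−1) t r` with `(1, r, −1, −r)`
vanishes at every `f₀` of the region, for every `t¹⁶ = −1` and every `r ≠ 0` off the denominator.
[cite: GlazmanManolescu2019, Lemma 2.1, eq. (2.2) (CR)] [cite: Glazman2015WeightedSAW, Lemma 3.1 (the σ = ℓ/8 families)] -/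
theorem vertexFunctional_ybCurve_eq_zero_of_two_door_cut_of_pow_sixteen {t : ℂ} (h16 : t ^ 16 = -1)
    {r : ℂ} (hr : r ≠ 0) (hD : t ^ 6 * (1 + r ^ 4) - (1 + t ^ 12) * r ^ 2 ≠ 0)
    (Dl : List Face) (a : MidEdge) {w : Face} (B : Set Face) (ha : ∃ s, w.side s = a)
    (huniq : ∀ f ∈ Dl, (∃ s, f.side s = a) → f = w) (hwB : w ∉ B) (d₁ d₂ : MidEdge)
    (hcut : ∀ f ∈ B, ∀ g ∈ Dl, g ∉ B → ∀ s s', f.side s = g.side s' → f.side s = d₁ ∨ f.side s = d₂)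
    {n : ℕ} {g : ℕ → Face} (hg0 : g 0 = w) (hoff : ∀ i ≤ n, g i ∉ B)
    (hlink : ∀ i < n, ∃ q : ℤ × ℤ, IsCornerOf q (g i) ∧ IsCornerOf q (g (i + 1))) (hDl : g n ∉ Dl)
    (hb : (∀ f ∈ Dl, (g n).1 < f.1) ∨ (∀ f ∈ Dl, f.1 < (g n).1) ∨ (∀ f ∈ Dl, (g n).2 < f.2) ∨ (∀ f ∈ Dl, f.2 < (g n).2))
    {f₀ : Face} (hf : f₀ ∈ Dl) (hfB : f₀ ∈ B) :
    vertexFunctional (ybCurve (-1) t r) t (oddCoeff r) Dl a f₀ = 0 :=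
  vertexFunctional_ybCurve_eq_zero_of_printed_of_pow_sixteen Dl a f₀
    (fun _ hθ => vertexFunctional_printed_eq_zero_of_two_door_cut hθ Dl a B ha huniq hwB d₁ d₂ hcut hg0 hoff
      hlink hDl hb hf hfB) h16 hr hD

/-- The `pendant` block zeros at every admissible spin on the whole curve.
[cite: GlazmanManolescu2019, Lemma 2.1, eq. (2.2) (CR)] -/
theorem vertexFunctional_ybCurve_pendant_block_eq_zero {t : ℂ} (h16 : t ^ 16 = -1) {r : ℂ} (hr : r ≠ 0)
    (hD : t ^ 6 * (1 + r ^ 4) - (1 + t ^ 12) * r ^ 2 ≠ 0) {f₀ : Face} (hf : f₀ ∈ pendantBlock) :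
    vertexFunctional (ybCurve (-1) t r) t (oddCoeff r) pendant (Face.side (2, 1) .W) f₀ = 0 :=
  vertexFunctional_ybCurve_eq_zero_of_printed_of_pow_sixteen _ _ _
    (fun _ hθ => vertexFunctional_printed_pendant_block_eq_zero hθ hf) h16 hr hD

/-- The thin-ring box zeros at every admissible spin on the whole curve.
[cite: GlazmanManolescu2019, Lemma 2.1, eq. (2.2) (CR)] -/
theorem vertexFunctional_ybCurve_holedBox_topRow_eq_zero {t : ℂ} (h16 : t ^ 16 = -1) {r : ℂ} (hr : r ≠ 0)
    (hD : t ^ 6 * (1 + r ^ 4) - (1 + t ^ 12) * r ^ 2 ≠ 0) (m n : ℕ) (h : Face) (hn : h.2 + 2 = n)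
    {f₀ : Face} (hf : f₀ ∈ holedBox m n h) (hfw : f₀ ≠ (h.1, h.2 + 1)) :
    vertexFunctional (ybCurve (-1) t r) t (oddCoeff r) (holedBox m n h) (Face.side h .N) f₀ = 0 :=
  vertexFunctional_ybCurve_eq_zero_of_printed_of_pow_sixteen _ _ _
    (fun _ hθ => vertexFunctional_printed_holedBox_topRow_eq_zero hθ m n h hn hf hfw) h16 hr hD

end Literature.Barriers.CriticalPhenomena.PlaquetteWalk
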